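import Summits.CriticalPhenomena.CardyFormulaZ2.Theorems.CardyBoundaryCoulombGasHalfPlaneMarkDensityLawDualUWalk
import Summits.CriticalPhenomena.CardyFormulaZ2.Theorems.CardyBoundaryCoulombGasHalfPlaneMarkDensityLawDualSeal
import Summits.CriticalPhenomena.CardyFormulaZ2.Theorems.CardyBoundaryCoulombGasHalfPlaneMarkDensityLawDualUProb

/-!
# `HalfPlaneMarkDensityLaw` (crux stmt-CriticalPhenomena-5661), line `Sketch`, lead c12-0, wave 2 assembly, part 0:
# the half-plane four-arc crossing probability stays below `1`; joint limits are `< 1` on the whole chamber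

`…NonDegeneracy.lean` bounded `P_n(a,b,c,y)` away from `1` only for a SMALL source arc (`12(b−a) < c−a`, one
blocked annulus) and left the regime `η → 1` open ("needs thin blocked half-annuli").  The dual U of this wave
does it uniformly: two dual top–bottom crossings of the face boxes over the gap `(b,c)` and over `(y+1, y+2)`
joined by a dual bar (`stub_dualU_prob`, probability `≥ cU > 0` eventually) form a moat-to-moat dual walk
(`stub_dualU_walk`) sealing `[⌊cn⌋, ⌊yn⌋]×{0}` from the source arc (`stub_dualSeal`), so
`P_n(a,b,c,y) ≤ 1 − cU` eventually (`stub_eventually_le_one_sub`) and every joint subsequential limit satisfies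
`G(a,b,c,y) < 1` on the whole chamber `{a < b < c < y}` (`stub_jointLimit_lt_one`).
-/

noncomputable section

namespace Summit.CriticalPhenomena.CardyFormulaZ2.Cruxes.HalfPlaneMarkDensityLaw.SketchLine

open Literature.Probability.Percolation Literature.Probability.LatticeModels
open MeasureTheory Filter Set SimpleGraph
open scoped Topology
open Summit.CriticalPhenomena.CardyFormulaZ2.Theorems.HalfPlaneMarkDensityLaw.Negative

namespace Window

/-! ### Eventually-in-`n` floor arithmetic -/

/-- Eventually-in-`n` floor facts for reals `s < t`: `⌊s n⌋ + 2 ≤ ⌊t n⌋`. [folklore] -/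
theorem eventually_floor_add_two_le {s t : ℝ} (hst : s < t) :
    ∀ᶠ n : ℕ in atTop, ⌊s * n⌋ + 2 ≤ ⌊t * n⌋ := by
  have hpos : 0 < t - s := sub_pos.2 hst
  have e1 : ∀ᶠ n : ℕ in atTop, (3 : ℝ) ≤ (t - s) * n :=
    (tendsto_natCast_atTop_atTop.const_mul_atTop hpos).eventually_ge_atTop _
  filter_upwards [e1] with n hn
  have h1 : ((⌊s * (n : ℝ)⌋ : ℤ) : ℝ) ≤ s * n := Int.floor_le _
  have h2 : (t * n : ℝ) < ⌊t * (n : ℝ)⌋ + 1 := Int.lt_floor_add_one _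
  have h3 : ((⌊s * (n : ℝ)⌋ + 2 : ℤ) : ℝ) < ((⌊t * (n : ℝ)⌋ + 1 : ℤ) : ℝ) := by
    push_cast; nlinarith
  have := Int.cast_lt.1 h3
  omega

/-- Eventually `1 ≤ ⌊t n⌋` for `t > 0`. [folklore] -/
theorem eventually_one_le_floor {t : ℝ} (ht : 0 < t) : ∀ᶠ n : ℕ in atTop, (2 : ℤ) ≤ ⌊t * n⌋ := by
  have e1 : ∀ᶠ n : ℕ in atTop, (2 : ℝ) ≤ t * n :=
    (tendsto_natCast_atTop_atTop.const_mul_atTop ht).eventually_ge_atTop _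
  filter_upwards [e1] with n hn
  exact Int.le_floor.2 (by push_cast; linarith)

/-! ### Below one -/

/-- **STUB (registered signature): `P_n(a,b,c,y) ≤ 1 − c₁` eventually**, for every point of the chamber. [folklore] -/
theorem stub_eventually_le_one_sub :
    ∀ (a b c y : ℝ), a < b → b < c → c < y →
      ∃ c₁ : ℝ, 0 < c₁ ∧ ∀ᶠ n : ℕ in atTop,
        μ.real (openCrossing halfPlane (arcA a b n) (rowIcc ⌊c * n⌋ ⌊y * n⌋)) ≤ 1 - c₁ := by
  intro a b c y hab hbc hcy
  classical
  set g₁ : ℝ := b + (c - b) / 3 with hg₁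
  set g₂ : ℝ := b + 2 * (c - b) / 3 with hg₂
  have hbg₁ : b < g₁ := by rw [hg₁]; linarith
  have hg₁₂ : g₁ < g₂ := by rw [hg₁, hg₂]; linarith
  have hg₂c : g₂ < c := by rw [hg₂]; linarith
  have hg₂y : g₂ < y + 1 := by linarith
  have hy12 : y + 1 < y + 2 := by linarith
  obtain ⟨cU, hcU0, hU⟩ := stub_dualU_prob g₁ g₂ (y + 1) (y + 2) (1 / 2) 1 hg₁₂ hg₂y hy12 (by norm_num) (by norm_num)
  refine ⟨cU, hcU0, ?_⟩
  filter_upwards [hU, eventually_floor_add_two_le hbg₁, eventually_floor_add_two_le hg₁₂,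
    eventually_floor_add_two_le hg₂c, eventually_floor_add_two_le hcy, eventually_floor_add_two_le (by linarith : y < y + 1),
    eventually_floor_add_two_le hy12, eventually_one_le_floor (one_half_pos : (0:ℝ) < 1 / 2),
    eventually_one_le_floor (one_pos : (0:ℝ) < 1)] with n hUn e1 e2 e3 e4 e5 e6 e7 e8
  set G₁ := ⌊g₁ * n⌋ with hG₁
  set G₂ := ⌊g₂ * n⌋ with hG₂
  set R₁ := ⌊(y + 1) * n⌋ with hR₁
  set R₂ := ⌊(y + 2) * n⌋ with hR₂
  set Hh := ⌊(1 / 2 : ℝ) * n⌋ with hHh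
  set H := ⌊(1 : ℝ) * n⌋ with hH
  have hHhH : Hh ≤ H := Int.floor_le_floor (by nlinarith [(Nat.cast_nonneg n : (0:ℝ) ≤ n)])
  set U : Set (BondConfig (Site 2)) := dualConfig ⁻¹' (
      openCrossing {z : Site 2 | G₁ ≤ z 0 ∧ z 0 ≤ G₂ ∧ -1 ≤ z 1 ∧ z 1 ≤ H} {z : Site 2 | z 1 = -1} {z : Site 2 | z 1 = H} ∩
      openCrossing {z : Site 2 | G₁ ≤ z 0 ∧ z 0 ≤ R₂ ∧ Hh ≤ z 1 ∧ z 1 ≤ H} {z : Site 2 | z 0 = G₁} {z : Site 2 | z 0 = R₂} ∩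
      openCrossing {z : Site 2 | R₁ ≤ z 0 ∧ z 0 ≤ R₂ ∧ -1 ≤ z 1 ∧ z 1 ≤ H} {z : Site 2 | z 1 = -1} {z : Site 2 | z 1 = H})
    with hUdef
  set E : Set (BondConfig (Site 2)) := openCrossing halfPlane (arcA a b n) (rowIcc ⌊c * n⌋ ⌊y * n⌋) with hEdef
  -- on the dual U (a.e.), the source arc is sealed from the target
  have hincl : ∀ᵐ ω ∂μ, ω ∈ U → ω ∈ Eᶜ := by
    rw [show μ = bondPercolation (zdGraph 2) half from rfl]
    filter_upwards [ae_subset_edgeSet (zdGraph 2) half] with ω hω hωU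
    obtain ⟨⟨hL, hB⟩, hR⟩ := hωU
    obtain ⟨p₁, p₂, hp₁, hp₁', hp₂, hp₂', Q, hQω, hQ1, hQ0⟩ :=
      stub_dualU_walk ω G₁ G₂ R₁ R₂ Hh H (by omega) (by omega) (by omega) (by omega) hHhH hL hB hR
    rintro ⟨u, ⟨hu1, -, hub⟩, v, ⟨hv1, hvc, hvy⟩, huv⟩
    exact stub_dualSeal ω hω p₁ p₂ (by omega) ⟨Q, hQω, hQ1, hQ0⟩ u v hu1 hv1 (by omega) (by omega) (by omega) huv
  have hEm : MeasurableSet E := measurableSet_openCrossing_of_countable _ _ _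
  have h1 : μ.real U ≤ μ.real Eᶜ := by
    rw [measureReal_def, measureReal_def]
    exact ENNReal.toReal_mono (measure_ne_top _ _) (measure_mono_ae hincl)
  have h2 : μ.real Eᶜ = 1 - μ.real E := by
    rw [measureReal_compl hEm, show μ = bondPercolation (zdGraph 2) half from rfl, probReal_univ]
  linarith

/-- **STUB (registered signature): joint subsequential limits are `< 1` on the whole chamber.** [folklore] -/
theorem stub_jointLimit_lt_one :
    ∀ {θ : ℕ → ℕ} {G : ℝ → ℝ → ℝ → ℝ → ℝ},
      (∀ a b c y : ℝ, a < b → b < c → c < y →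
        Tendsto (fun n ↦ μ.real (openCrossing halfPlane (arcA a b (θ n))
          (rowIcc ⌊c * (θ n : ℕ)⌋ ⌊y * (θ n : ℕ)⌋))) atTop (𝓝 (G a b c y))) →
      StrictMono θ → ∀ {a b c y : ℝ}, a < b → b < c → c < y → G a b c y < 1 := by
  intro θ G hG hθ a b c y hab hbc hcy
  obtain ⟨c₁, hc₁, hev⟩ := stub_eventually_le_one_sub a b c y hab hbc hcy
  have hle : G a b c y ≤ 1 - c₁ :=
    le_of_tendsto (hG a b c y hab hbc hcy) (hθ.tendsto_atTop.eventually hev)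
  linarith

end Window

end Summit.CriticalPhenomena.CardyFormulaZ2.Cruxes.HalfPlaneMarkDensityLaw.SketchLine
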